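import Summits.Ventures.CertifiedManyBodySolver.Observables.StiffnessApexTransportMirrorFanWitness
import HarnessLib

/-!
# Ventures/CertifiedManyBodySolver — Observables/StiffnessApexTransportMottStationFan.lean

HONEST FRAMING: one-sided certified CEILINGS on the uniform flux stiffness (t–t′ f-sum class) at HALF FILLING (`n = 1`, Mott CONTROL/CALIBRATION line; `ρ_s = 0`
there in print is NOT a theorem here): the PH-signed `t′ = 0` MOTT STATION (this seat's `Observables/StiffnessApexTransportMottStation.lean`) bracketed with a
`t′ < 0` FAN SOURCE of the tree (its own f-sum word plus its `K₂` hinge) instead of a Fermi-sea row — and, for `t′ > 0` targets, with the particle–hole MIRROR of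
that fan (`Observables/StiffnessApexTransportMirrorFanWitness.lean`). Every leaf is conditional on the rows / claim nodes it names; a ceiling never speaks to the
presence of order; not a `T_c` / superconductivity verdict; no number of record. Zero compute, no definition, no claim node, no `sorry`.

Cell `pub/hubbard-fast` (D-0154 (1)(A) «CERTIFICATE REUSE along parameter paths»), seat `hubbard-fast-reuse-2` g5 (`prover-hubbard-fast-reuse-2-g5-0`), path family
«APEX TRANSPORT», line «PH-SIGNED MOTT STATION», device «MOTT × FAN».

THE POINT. In the weighted bracket at a `t′ < 0` half-filled target the LEFT member must floor `e_{Φ(1,κ,0)}` at a hopping `κ < 2t′`. A kernel Fermi-sea row costs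
`−ℓ/4 ≈ 0.43` at `κ = −½`; a fan source `(s, U_B, 1)` (own word `v`, `K₂ ∈ [0, A]` by the half-filling sign and its `K₂` node) floors `e_{Φ(1,κ_B,0)}` at its apex hopping
`κ_B = (U s − U_B t′)/(U − U_B)` by `4v` (free, `κ_B ≥ 2s`) or `4v + (κ_B − 2s)A` (priced, `κ_B ≤ 2s`) — i.e. words `−v + max(2s − κ_B, 0)·A/4 ≈ 0.30–0.45` far to the LEFT
(`κ_B ≈ −0.4 … −1.6`), which makes the Mott weight `μ_A = (2t′ − κ_B)/(κ_A − κ_B)` large. The target-side hinge of the fan engines disappears: the bracket evaluates at `2t′` exactly.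

* §1 `ObsStiffnessSeqCeilingAt_of_two_apexSourceWitnesses_weighted` — both sources by witness (any density);
* §2 `forall_torusLimit_halfFilling_diagHop_nonneg_of_tPrime_neg` — `0 ≤ K₂` on a half-filled class with `t′ < 0` (the free fan orientation);
* §3 `t′ ≤ 0` leaves «Mott (right) × fan (left)»: `…_mottStation_fanFree_leftLeaf` (`2s ≤ κ_B < 2t′`) and `…_mottStation_fanPriced_leftLeaf` (`κ_B ≤ 2s`, ceiling `A`);
* §4 `t′ ≥ 0` leaves «Mott (left) × MIRRORED fan (right)»: the fan floor at `−κ_B⁺` carried to the mirror class `(−s, U_B, 1)` by `exists_torusLimit_halfFilling_mirror_hoppingFloor`,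
  `κ_B⁺ = (U(−s) − U_B t′)/(U − U_B) > 2t′`; free (`κ_B⁺ ≤ −2s`) and priced (`κ_B⁺ ≥ −2s`) editions — along EVERY sequence of sides.

NOT said: nothing flows toward `U_P ≤ max(U_A, U_B)`; the free orientation and the mirror are HALF-FILLING facts; `λ ≠ 0` words are not of this form; no `T > 0`; no number here.

References: T. Koma, H. Tasaki, J. Stat. Phys. 76 (1994) 745, §1 [KomaTasaki1994]; D. J. Scalapino, S. R. White, S.-C. Zhang, PRB 47 (1993) 7995, §II [ScalapinoWhiteZhang1993];
E. H. Lieb, F. Y. Wu, Physica A 321 (2003) 1, §1 eq. (3) [LiebWuPhysicaA2003]; T. Hazra, N. Verma, M. Randeria, PRX 9 (2019) 031049, eq. (4) [HazraVermaRanderia2019].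
-/

noncomputable section

namespace Summit.Ventures.CertifiedManyBodySolver.Observables

open Literature.MathematicalPhysics.QuantumLattice
open Literature.MathematicalPhysics.QuantumLattice.ThermodynamicLimit
open Literature.MathematicalPhysics.QuantumFieldTheory
open Literature.Probability.LatticeModels
open Matrix Finset Filter Topology HubbardWave0
open scoped Matrix BigOperators ComplexOrder

/-! ## §1 Two witnesses -/

section TwoWitnesses

variable {t'P UP n s₁ U₁ s₂ U₂ : ℝ}

/-- **TWO-SOURCE WEIGHTED BRACKET, BOTH sources by WITNESS (any density).** Sources `(s_i, U_i)`, `0 ≤ U_i < U_P`, each given by ONE torus-limit ground state `ω_i`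
of its class with `ℓ_i ≤ e_{Φ(1,κ_i,0)}(ω_i)` at the apex hopping `κ_i = (U_P s_i − U_i t′_P)/(U_P − U_i)`; weights `μ_i ≥ 0`, `μ₁ + μ₂ = 1`, `μ₁κ₁ + μ₂κ₂ = 2t′_P`. Then
`ObsStiffnessSeqCeilingAt t′_P U_P n c` for every rational `c ≥ −(μ₁ℓ₁ + μ₂ℓ₂)/4`. [cite: KomaTasaki1994, §1] [cite: ScalapinoWhiteZhang1993, §II] -/
theorem ObsStiffnessSeqCeilingAt_of_two_apexSourceWitnesses_weighted (hU₁0 : 0 ≤ U₁) (hU₁ : U₁ < UP) (hU₂0 : 0 ≤ U₂) (hU₂ : U₂ < UP)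
    (hn0 : 0 ≤ n) (hn2 : n < 2) {μ₁ μ₂ : ℝ} (hμ₁ : 0 ≤ μ₁) (hμ₂ : 0 ≤ μ₂) (hμ : μ₁ + μ₂ = 1)
    (hκ : μ₁ * ((UP * s₁ - U₁ * t'P) / (UP - U₁)) + μ₂ * ((UP * s₂ - U₂ * t'P) / (UP - U₂)) = 2 * t'P) {ℓ₁ ℓ₂ : ℝ}
    (h₁ : ∃ (ω : InfVolFermionState 2) (Ls : ℕ → ℕ) (ψ : ∀ L, Fock (Orb (FermionTorus 2 L))),
      Tendsto Ls atTop atTop ∧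
      (∀ j, IsGroundStateInSector (hubbardTorusTT' (Ls j) 1 s₁ U₁) (rectN n (Ls j)) 0 (ψ (Ls j))) ∧
      (∀ j, star (ψ (Ls j)) ⬝ᵥ ψ (Ls j) = 1) ∧ ω.IsTorusLimitOf ψ Ls ∧
      ℓ₁ ≤ ω.meanEnergy (hubbardTTPrimeFermionInteraction 1 ((UP * s₁ - U₁ * t'P) / (UP - U₁)) 0) 1)
    (h₂ : ∃ (ω : InfVolFermionState 2) (Ls : ℕ → ℕ) (ψ : ∀ L, Fock (Orb (FermionTorus 2 L))),
      Tendsto Ls atTop atTop ∧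
      (∀ j, IsGroundStateInSector (hubbardTorusTT' (Ls j) 1 s₂ U₂) (rectN n (Ls j)) 0 (ψ (Ls j))) ∧
      (∀ j, star (ψ (Ls j)) ⬝ᵥ ψ (Ls j) = 1) ∧ ω.IsTorusLimitOf ψ Ls ∧
      ℓ₂ ≤ ω.meanEnergy (hubbardTTPrimeFermionInteraction 1 ((UP * s₂ - U₂ * t'P) / (UP - U₂)) 0) 1)
    (c : ℚ) (hc : -(μ₁ * ℓ₁ + μ₂ * ℓ₂) / 4 ≤ ((c : ℚ) : ℝ)) :
    ObsStiffnessSeqCeilingAt t'P UP n c := by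
  intro ρs θ₀ _ hθ₀ Ls hLs hst
  refine fluxStiffness_le_of_torusLimitTT'_oddMoment_orbit_certificate_seq t'P (U := UP) (δ := 1 - n) (q := ((c : ℚ) : ℝ)) 0
    Finset.univ Finset.univ_nonempty (by linarith) (by linarith) hθ₀ hLs hst ?_
  intro ω Ms ψ hMs hψ h1 hω
  have hψ' : ∀ j, IsGroundStateInSector (hubbardTorusTT' (Ms j) 1 t'P UP) (rectN n (Ms j)) 0 (ψ (Ms j)) := fun j => by
    simpa only [sub_sub_cancel] using hψ j
  rw [orbitMean_rotOddMomentLimitFunctionalTT_lam_zero_eq_meanEnergy_twice_tPrime hω.isTranslationInvariant]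
  obtain ⟨ω₁, L₁, φ₁, hL₁, hφ₁, hφ₁1, hω₁, hl₁⟩ := h₁
  obtain ⟨ω₂, L₂, φ₂, hL₂, hφ₂, hφ₂1, hω₂, hl₂⟩ := h₂
  have hapx₁ := InfVolFermionState.IsTorusLimitOf.meanEnergy_apexHopping_le_of_groundStates 1 s₁ t'P hU₁0 hU₁ hn0 hn2
    hω₁ hL₁ hφ₁ hφ₁1 hω hMs hψ' h1
  have hapx₂ := InfVolFermionState.IsTorusLimitOf.meanEnergy_apexHopping_le_of_groundStates 1 s₂ t'P hU₂0 hU₂ hn0 hn2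
    hω₂ hL₂ hφ₂ hφ₂1 hω hMs hψ' h1
  set κ₁ : ℝ := (UP * s₁ - U₁ * t'P) / (UP - U₁) with hκ₁
  set κ₂ : ℝ := (UP * s₂ - U₂ * t'P) / (UP - U₂) with hκ₂
  have e₁ := ω.meanEnergy_hubbardTTPrime_eq_coords 1 κ₁ 0
  have e₂ := ω.meanEnergy_hubbardTTPrime_eq_coords 1 κ₂ 0
  have eP := ω.meanEnergy_hubbardTTPrime_eq_coords 1 (2 * t'P) 0
  have haff : ω.meanEnergy (hubbardTTPrimeFermionInteraction 1 (2 * t'P) 0) 1 =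
      μ₁ * ω.meanEnergy (hubbardTTPrimeFermionInteraction 1 κ₁ 0) 1 +
        μ₂ * ω.meanEnergy (hubbardTTPrimeFermionInteraction 1 κ₂ 0) 1 := by
    rw [e₁, e₂, eP, ← hκ]
    linear_combination (ω.meanEnergy (hubbardTTPrimeFermionInteraction 1 0 0) 1) * hμ.symm
  have hw₁ := mul_le_mul_of_nonneg_left (hl₁.trans hapx₁) hμ₁
  have hw₂ := mul_le_mul_of_nonneg_left (hl₂.trans hapx₂) hμ₂
  have hc' : -(μ₁ * ℓ₁ + μ₂ * ℓ₂) / 4 ≤ ((c : ℚ) : ℝ) := hc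
  rw [haff]
  linarith

end TwoWitnesses

/-! ## §2 The free fan orientation at half filling: `t′ < 0 ⇒ 0 ≤ K₂` on the whole class -/

/-- **`0 ≤ K₂(ω)` for every torus-limit ground state of a half-filled class with `t′ < 0`** (`U ≥ 0`; from `t′·K₂ ≤ 0`,
`IsTorusLimitOf.tPrime_mul_diagHopEnergy_nonpos_of_groundState_halfFilling`). [cite: KomaTasaki1994, §1] [cite: LiebWuPhysicaA2003, §1 eq. (3)] -/
theorem forall_torusLimit_halfFilling_diagHop_nonneg_of_tPrime_neg {s U : ℝ} (hs : s < 0) (hU : 0 ≤ U) :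
    ∀ (ω : InfVolFermionState 2) (Ls : ℕ → ℕ) (ψ : ∀ L, Fock (Orb (FermionTorus 2 L))),
      Tendsto Ls atTop atTop →
      (∀ j, IsGroundStateInSector (hubbardTorusTT' (Ls j) 1 s U) (rectN 1 (Ls j)) 0 (ψ (Ls j))) →
      (∀ j, star (ψ (Ls j)) ⬝ᵥ ψ (Ls j) = 1) → ω.IsTorusLimitOf ψ Ls →
      (0 : ℝ) ≤ ω.meanEnergy (hubbardTTPrimeFermionInteraction 0 1 0) 1 := by
  intro ω Ls ψ hLs hψ h1 hω
  have h := InfVolFermionState.IsTorusLimitOf.tPrime_mul_diagHopEnergy_nonpos_of_groundState_halfFilling 1 s hU hω hLs hψ h1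
  nlinarith

/-! ## §3 `t′ ≤ 0`: Mott station on the RIGHT (PH-signed witness) × fan source on the LEFT -/

section LeftLeaves

variable {U₀ X s₂ U₂ UP t'P : ℝ}

/-- **MOTT × FAN, `t′ ≤ 0`, FREE fan orientation.** Station `(0, U₀)` (`0 ≤ U₀ < U_P`, kinetic ceiling `−k ≤ X`); fan class `(s₂, U₂, 1)` (`s₂ < 0`, `0 ≤ U₂ < U_P`) with its own f-sum
orbit-lower family `v₂` at the slot `s₂`; apex hoppings `κ_A = −U₀t′/(U_P − U₀)`, `κ_B = (U_P s₂ − U₂t′)/(U_P − U₂)` with `2s₂ ≤ κ_B < 2t′` (target right of the fan's apex line,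
inside the free fan); natural weights `μ_A = (2t′ − κ_B)/(κ_A − κ_B)`, `μ_B = (κ_A − 2t′)/(κ_A − κ_B)`: `c ≥ μ_A·X/4 + μ_B·(−v₂)` gives `ObsStiffnessSeqCeilingAt t′ U_P 1 c`.
[cite: KomaTasaki1994, §1] [cite: ScalapinoWhiteZhang1993, §II] [cite: LiebWuPhysicaA2003, §1 eq. (3)] -/
theorem ObsStiffnessSeqCeilingAt_halfFilling_mottStation_fanFree_leftLeaf (Uo₂ : ℝ) (hU₀ : 0 ≤ U₀)
    (hX : ∀ (ω : InfVolFermionState 2) (Ls : ℕ → ℕ) (ψ : ∀ L, Fock (Orb (FermionTorus 2 L))),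
      Tendsto Ls atTop atTop →
      (∀ j, IsGroundStateInSector (hubbardTorusTT' (Ls j) 1 0 U₀) (rectN 1 (Ls j)) 0 (ψ (Ls j))) →
      (∀ j, star (ψ (Ls j)) ⬝ᵥ ψ (Ls j) = 1) → ω.IsTorusLimitOf ψ Ls →
      -(∑ i : Fin 2, -(1 : ℝ) * ∑ σ : Fin 2,
          ((ω.expect {0, 0 + unitVec i}
              ((cAt 0 (mem_insert_self _ _) σ)ᴴ * cAt (0 + unitVec i) (mem_insert_of_mem (mem_singleton_self _)) σ)).re +
            (ω.expect {0, 0 + unitVec i}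
              ((cAt (0 + unitVec i) (mem_insert_of_mem (mem_singleton_self _)) σ)ᴴ * cAt 0 (mem_insert_self _ _) σ)).re)) ≤ X)
    (hs₂ : s₂ < 0) (hU₂0 : 0 ≤ U₂) {v₂ : ℝ}
    (h₂ : ∀ (ω : InfVolFermionState 2) (Ls : ℕ → ℕ) (ψ : ∀ L, Fock (Orb (FermionTorus 2 L))),
      Tendsto Ls atTop atTop →
      (∀ j, IsGroundStateInSector (hubbardTorusTT' (Ls j) 1 s₂ U₂) (rectN 1 (Ls j)) 0 (ψ (Ls j))) →
      (∀ j, star (ψ (Ls j)) ⬝ᵥ ψ (Ls j) = 1) → ω.IsTorusLimitOf ψ Ls →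
      v₂ ≤ ((Finset.univ : Finset (DihedralGroup 4)).card : ℝ)⁻¹ * ∑ g ∈ (Finset.univ : Finset (DihedralGroup 4)),
        (ω.expect (d4ShiftSet g 0 (box 2 7)) (fermionEmbed (PolySite.d4Emb g 0 (box 2 7)) (-oddMomentObsTT s₂ Uo₂ 0))).re)
    (hUA : U₀ < UP) (hUB : U₂ < UP) (ht : t'P ≤ 0)
    (hfree : 2 * s₂ ≤ (UP * s₂ - U₂ * t'P) / (UP - U₂)) (hleft : (UP * s₂ - U₂ * t'P) / (UP - U₂) < 2 * t'P) (c : ℚ)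
    (hc : (2 * t'P - (UP * s₂ - U₂ * t'P) / (UP - U₂)) / ((UP * 0 - U₀ * t'P) / (UP - U₀) - (UP * s₂ - U₂ * t'P) / (UP - U₂)) * (X / 4) +
      ((UP * 0 - U₀ * t'P) / (UP - U₀) - 2 * t'P) / ((UP * 0 - U₀ * t'P) / (UP - U₀) - (UP * s₂ - U₂ * t'P) / (UP - U₂)) * (-v₂) ≤ ((c : ℚ) : ℝ)) :
    ObsStiffnessSeqCeilingAt t'P UP 1 c := by
  have hd : 0 < UP - U₀ := by linarith
  have hR : 2 * t'P ≤ (UP * 0 - U₀ * t'P) / (UP - U₀) := by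
    rw [le_div_iff₀ hd]; nlinarith [mul_nonneg_of_nonpos_of_nonpos ht (by linarith : -(2 * UP - U₀) ≤ 0)]
  have hlt : (UP * s₂ - U₂ * t'P) / (UP - U₂) < (UP * 0 - U₀ * t'P) / (UP - U₀) := lt_of_lt_of_le hleft hR
  obtain ⟨hμ₁, hμ₂, hsum, hcomb⟩ := anchor_weights_left hlt hleft.le hR
  refine ObsStiffnessSeqCeilingAt_of_apexSourceWitness_apexSource_weighted (s₁ := 0) (n := 1) hU₀ hUA hU₂0 hUB zero_le_one one_lt_two
    hμ₁ hμ₂ hsum hcomb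
    (exists_torusLimit_halfFilling_tp0_hoppingFloor_of_negKinetic_le ((UP * 0 - U₀ * t'P) / (UP - U₀)) hX)
    (hoppingFloor_of_ownSlot_orbitLower_of_le_diagHop Uo₂ v₂ hfree h₂
      (forall_torusLimit_halfFilling_diagHop_nonneg_of_tPrime_neg hs₂ hU₂0)) c ?_
  have e : -((2 * t'P - (UP * s₂ - U₂ * t'P) / (UP - U₂)) / ((UP * 0 - U₀ * t'P) / (UP - U₀) - (UP * s₂ - U₂ * t'P) / (UP - U₂)) * (-X) +
      ((UP * 0 - U₀ * t'P) / (UP - U₀) - 2 * t'P) / ((UP * 0 - U₀ * t'P) / (UP - U₀) - (UP * s₂ - U₂ * t'P) / (UP - U₂)) *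
        (4 * v₂ + ((UP * s₂ - U₂ * t'P) / (UP - U₂) - 2 * s₂) * 0)) / 4 =
      (2 * t'P - (UP * s₂ - U₂ * t'P) / (UP - U₂)) / ((UP * 0 - U₀ * t'P) / (UP - U₀) - (UP * s₂ - U₂ * t'P) / (UP - U₂)) * (X / 4) +
      ((UP * 0 - U₀ * t'P) / (UP - U₀) - 2 * t'P) / ((UP * 0 - U₀ * t'P) / (UP - U₀) - (UP * s₂ - U₂ * t'P) / (UP - U₂)) * (-v₂) := by ring
  rw [e]; exact hc

/-- **MOTT × FAN, `t′ ≤ 0`, PRICED fan orientation.** As above with `κ_B ≤ 2s₂` (the target's apex line meets the fan station LEFT of its slot) and a CEILING `K₂ ≤ A₂` on the fan class: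
the fan floor at `κ_B` is `4v₂ + (κ_B − 2s₂)A₂`, so `c ≥ μ_A·X/4 + μ_B·(−v₂ + (2s₂ − κ_B)A₂/4)`. [cite: KomaTasaki1994, §1] [cite: ScalapinoWhiteZhang1993, §II] -/
theorem ObsStiffnessSeqCeilingAt_halfFilling_mottStation_fanPriced_leftLeaf (Uo₂ : ℝ) (hU₀ : 0 ≤ U₀)
    (hX : ∀ (ω : InfVolFermionState 2) (Ls : ℕ → ℕ) (ψ : ∀ L, Fock (Orb (FermionTorus 2 L))),
      Tendsto Ls atTop atTop →
      (∀ j, IsGroundStateInSector (hubbardTorusTT' (Ls j) 1 0 U₀) (rectN 1 (Ls j)) 0 (ψ (Ls j))) →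
      (∀ j, star (ψ (Ls j)) ⬝ᵥ ψ (Ls j) = 1) → ω.IsTorusLimitOf ψ Ls →
      -(∑ i : Fin 2, -(1 : ℝ) * ∑ σ : Fin 2,
          ((ω.expect {0, 0 + unitVec i}
              ((cAt 0 (mem_insert_self _ _) σ)ᴴ * cAt (0 + unitVec i) (mem_insert_of_mem (mem_singleton_self _)) σ)).re +
            (ω.expect {0, 0 + unitVec i}
              ((cAt (0 + unitVec i) (mem_insert_of_mem (mem_singleton_self _)) σ)ᴴ * cAt 0 (mem_insert_self _ _) σ)).re)) ≤ X)
    (hU₂0 : 0 ≤ U₂) {v₂ : ℝ}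
    (h₂ : ∀ (ω : InfVolFermionState 2) (Ls : ℕ → ℕ) (ψ : ∀ L, Fock (Orb (FermionTorus 2 L))),
      Tendsto Ls atTop atTop →
      (∀ j, IsGroundStateInSector (hubbardTorusTT' (Ls j) 1 s₂ U₂) (rectN 1 (Ls j)) 0 (ψ (Ls j))) →
      (∀ j, star (ψ (Ls j)) ⬝ᵥ ψ (Ls j) = 1) → ω.IsTorusLimitOf ψ Ls →
      v₂ ≤ ((Finset.univ : Finset (DihedralGroup 4)).card : ℝ)⁻¹ * ∑ g ∈ (Finset.univ : Finset (DihedralGroup 4)),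
        (ω.expect (d4ShiftSet g 0 (box 2 7)) (fermionEmbed (PolySite.d4Emb g 0 (box 2 7)) (-oddMomentObsTT s₂ Uo₂ 0))).re)
    {A₂ : ℝ}
    (hA₂ : ∀ (ω : InfVolFermionState 2) (Ls : ℕ → ℕ) (ψ : ∀ L, Fock (Orb (FermionTorus 2 L))),
      Tendsto Ls atTop atTop →
      (∀ j, IsGroundStateInSector (hubbardTorusTT' (Ls j) 1 s₂ U₂) (rectN 1 (Ls j)) 0 (ψ (Ls j))) →
      (∀ j, star (ψ (Ls j)) ⬝ᵥ ψ (Ls j) = 1) → ω.IsTorusLimitOf ψ Ls →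
      ω.meanEnergy (hubbardTTPrimeFermionInteraction 0 1 0) 1 ≤ A₂)
    (hUA : U₀ < UP) (hUB : U₂ < UP) (ht : t'P ≤ 0)
    (hpriced : (UP * s₂ - U₂ * t'P) / (UP - U₂) ≤ 2 * s₂) (hleft : (UP * s₂ - U₂ * t'P) / (UP - U₂) < 2 * t'P) (c : ℚ)
    (hc : (2 * t'P - (UP * s₂ - U₂ * t'P) / (UP - U₂)) / ((UP * 0 - U₀ * t'P) / (UP - U₀) - (UP * s₂ - U₂ * t'P) / (UP - U₂)) * (X / 4) +
      ((UP * 0 - U₀ * t'P) / (UP - U₀) - 2 * t'P) / ((UP * 0 - U₀ * t'P) / (UP - U₀) - (UP * s₂ - U₂ * t'P) / (UP - U₂)) *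
        (-v₂ + (2 * s₂ - (UP * s₂ - U₂ * t'P) / (UP - U₂)) * A₂ / 4) ≤ ((c : ℚ) : ℝ)) :
    ObsStiffnessSeqCeilingAt t'P UP 1 c := by
  have hd : 0 < UP - U₀ := by linarith
  have hR : 2 * t'P ≤ (UP * 0 - U₀ * t'P) / (UP - U₀) := by
    rw [le_div_iff₀ hd]; nlinarith [mul_nonneg_of_nonpos_of_nonpos ht (by linarith : -(2 * UP - U₀) ≤ 0)]
  have hlt : (UP * s₂ - U₂ * t'P) / (UP - U₂) < (UP * 0 - U₀ * t'P) / (UP - U₀) := lt_of_lt_of_le hleft hR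
  obtain ⟨hμ₁, hμ₂, hsum, hcomb⟩ := anchor_weights_left hlt hleft.le hR
  refine ObsStiffnessSeqCeilingAt_of_apexSourceWitness_apexSource_weighted (s₁ := 0) (n := 1) hU₀ hUA hU₂0 hUB zero_le_one one_lt_two
    hμ₁ hμ₂ hsum hcomb
    (exists_torusLimit_halfFilling_tp0_hoppingFloor_of_negKinetic_le ((UP * 0 - U₀ * t'P) / (UP - U₀)) hX)
    (hoppingFloor_of_ownSlot_orbitLower_of_diagHop_le Uo₂ v₂ hpriced h₂ hA₂) c ?_
  have e : -((2 * t'P - (UP * s₂ - U₂ * t'P) / (UP - U₂)) / ((UP * 0 - U₀ * t'P) / (UP - U₀) - (UP * s₂ - U₂ * t'P) / (UP - U₂)) * (-X) +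
      ((UP * 0 - U₀ * t'P) / (UP - U₀) - 2 * t'P) / ((UP * 0 - U₀ * t'P) / (UP - U₀) - (UP * s₂ - U₂ * t'P) / (UP - U₂)) *
        (4 * v₂ + ((UP * s₂ - U₂ * t'P) / (UP - U₂) - 2 * s₂) * A₂)) / 4 =
      (2 * t'P - (UP * s₂ - U₂ * t'P) / (UP - U₂)) / ((UP * 0 - U₀ * t'P) / (UP - U₀) - (UP * s₂ - U₂ * t'P) / (UP - U₂)) * (X / 4) +
      ((UP * 0 - U₀ * t'P) / (UP - U₀) - 2 * t'P) / ((UP * 0 - U₀ * t'P) / (UP - U₀) - (UP * s₂ - U₂ * t'P) / (UP - U₂)) *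
        (-v₂ + (2 * s₂ - (UP * s₂ - U₂ * t'P) / (UP - U₂)) * A₂ / 4) := by ring
  rw [e]; exact hc

end LeftLeaves

/-! ## §4 `t′ ≥ 0`: Mott station on the LEFT × the MIRRORED fan witness on the RIGHT — every sequence of sides -/

section RightLeaves

variable {U₀ X s₂ U₂ UP t'P : ℝ}

/-- **MOTT × MIRRORED FAN, `t′ ≥ 0`, FREE orientation.** Station `(0, U₀)` (witness, `κ_A = −U₀t′/(U_P − U₀) ≤ 2t′`); fan class `(s₂, U₂, 1)`, `s₂ < 0`, own family `v₂`;
the MIRROR class `(−s₂, U₂, 1)` has apex hopping `κ_B⁺ = (U_P(−s₂) − U₂t′)/(U_P − U₂)` from the target, `2t′ < κ_B⁺`, and carries — by ONE mirrored witness — the fan floor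
read at `−κ_B⁺` (free orientation `2s₂ ≤ −κ_B⁺`): `c ≥ μ_A·X/4 + μ_B·(−v₂)`, `μ_A = (κ_B⁺ − 2t′)/(κ_B⁺ − κ_A)`. [cite: KomaTasaki1994, §1] [cite: LiebWuPhysicaA2003, §1 eq. (3)] -/
theorem ObsStiffnessSeqCeilingAt_halfFilling_mottStation_mirrorFanFree_rightLeaf (Uo₂ : ℝ) (hU₀ : 0 ≤ U₀)
    (hX : ∀ (ω : InfVolFermionState 2) (Ls : ℕ → ℕ) (ψ : ∀ L, Fock (Orb (FermionTorus 2 L))),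
      Tendsto Ls atTop atTop →
      (∀ j, IsGroundStateInSector (hubbardTorusTT' (Ls j) 1 0 U₀) (rectN 1 (Ls j)) 0 (ψ (Ls j))) →
      (∀ j, star (ψ (Ls j)) ⬝ᵥ ψ (Ls j) = 1) → ω.IsTorusLimitOf ψ Ls →
      -(∑ i : Fin 2, -(1 : ℝ) * ∑ σ : Fin 2,
          ((ω.expect {0, 0 + unitVec i}
              ((cAt 0 (mem_insert_self _ _) σ)ᴴ * cAt (0 + unitVec i) (mem_insert_of_mem (mem_singleton_self _)) σ)).re +
            (ω.expect {0, 0 + unitVec i}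
              ((cAt (0 + unitVec i) (mem_insert_of_mem (mem_singleton_self _)) σ)ᴴ * cAt 0 (mem_insert_self _ _) σ)).re)) ≤ X)
    (hs₂ : s₂ < 0) (hU₂0 : 0 ≤ U₂) {v₂ : ℝ}
    (h₂ : ∀ (ω : InfVolFermionState 2) (Ls : ℕ → ℕ) (ψ : ∀ L, Fock (Orb (FermionTorus 2 L))),
      Tendsto Ls atTop atTop →
      (∀ j, IsGroundStateInSector (hubbardTorusTT' (Ls j) 1 s₂ U₂) (rectN 1 (Ls j)) 0 (ψ (Ls j))) →
      (∀ j, star (ψ (Ls j)) ⬝ᵥ ψ (Ls j) = 1) → ω.IsTorusLimitOf ψ Ls →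
      v₂ ≤ ((Finset.univ : Finset (DihedralGroup 4)).card : ℝ)⁻¹ * ∑ g ∈ (Finset.univ : Finset (DihedralGroup 4)),
        (ω.expect (d4ShiftSet g 0 (box 2 7)) (fermionEmbed (PolySite.d4Emb g 0 (box 2 7)) (-oddMomentObsTT s₂ Uo₂ 0))).re)
    (hUA : U₀ < UP) (hUB : U₂ < UP) (ht : 0 ≤ t'P)
    (hfree : 2 * s₂ ≤ -((UP * (-s₂) - U₂ * t'P) / (UP - U₂))) (hright : 2 * t'P < (UP * (-s₂) - U₂ * t'P) / (UP - U₂)) (c : ℚ)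
    (hc : ((UP * (-s₂) - U₂ * t'P) / (UP - U₂) - 2 * t'P) / ((UP * (-s₂) - U₂ * t'P) / (UP - U₂) - (UP * 0 - U₀ * t'P) / (UP - U₀)) * (X / 4) +
      (2 * t'P - (UP * 0 - U₀ * t'P) / (UP - U₀)) / ((UP * (-s₂) - U₂ * t'P) / (UP - U₂) - (UP * 0 - U₀ * t'P) / (UP - U₀)) * (-v₂) ≤ ((c : ℚ) : ℝ)) :
    ObsStiffnessSeqCeilingAt t'P UP 1 c := by
  have hd : 0 < UP - U₀ := by linarith
  have hL : (UP * 0 - U₀ * t'P) / (UP - U₀) ≤ 2 * t'P := by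
    rw [div_le_iff₀ hd]; nlinarith [mul_nonneg ht (by linarith : 0 ≤ 2 * UP - U₀)]
  have hlt : (UP * 0 - U₀ * t'P) / (UP - U₀) < (UP * (-s₂) - U₂ * t'P) / (UP - U₂) := lt_of_le_of_lt hL hright
  obtain ⟨hμ₁, hμ₂, hsum, hcomb⟩ := bracket_weights hlt hL hright.le
  -- the fan floor at −κ_B⁺ on the ORIGINAL class, then mirrored to the class (−s₂, U₂)
  have hfloor := hoppingFloor_of_ownSlot_orbitLower_of_le_diagHop Uo₂ v₂ hfree h₂
    (forall_torusLimit_halfFilling_diagHop_nonneg_of_tPrime_neg hs₂ hU₂0)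
  have hwit := exists_torusLimit_halfFilling_mirror_hoppingFloor (-((UP * (-s₂) - U₂ * t'P) / (UP - U₂))) hfloor
  simp only [neg_neg] at hwit
  refine ObsStiffnessSeqCeilingAt_of_two_apexSourceWitnesses_weighted (s₁ := 0) (s₂ := -s₂) (n := 1) hU₀ hUA hU₂0 hUB zero_le_one one_lt_two
    hμ₁ hμ₂ hsum hcomb
    (exists_torusLimit_halfFilling_tp0_hoppingFloor_of_negKinetic_le ((UP * 0 - U₀ * t'P) / (UP - U₀)) hX) hwit c ?_
  have e : -(((UP * (-s₂) - U₂ * t'P) / (UP - U₂) - 2 * t'P) / ((UP * (-s₂) - U₂ * t'P) / (UP - U₂) - (UP * 0 - U₀ * t'P) / (UP - U₀)) * (-X) +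
      (2 * t'P - (UP * 0 - U₀ * t'P) / (UP - U₀)) / ((UP * (-s₂) - U₂ * t'P) / (UP - U₂) - (UP * 0 - U₀ * t'P) / (UP - U₀)) *
        (4 * v₂ + (-((UP * (-s₂) - U₂ * t'P) / (UP - U₂)) - 2 * s₂) * 0)) / 4 =
      ((UP * (-s₂) - U₂ * t'P) / (UP - U₂) - 2 * t'P) / ((UP * (-s₂) - U₂ * t'P) / (UP - U₂) - (UP * 0 - U₀ * t'P) / (UP - U₀)) * (X / 4) +
      (2 * t'P - (UP * 0 - U₀ * t'P) / (UP - U₀)) / ((UP * (-s₂) - U₂ * t'P) / (UP - U₂) - (UP * 0 - U₀ * t'P) / (UP - U₀)) * (-v₂) := by ring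
  rw [e]; exact hc

/-- **MOTT × MIRRORED FAN, `t′ ≥ 0`, PRICED orientation** (`−κ_B⁺ ≤ 2s₂`, ceiling `K₂ ≤ A₂` on the fan class): `c ≥ μ_A·X/4 + μ_B·(−v₂ + (2s₂ + κ_B⁺)A₂/4)`.
[cite: KomaTasaki1994, §1] [cite: LiebWuPhysicaA2003, §1 eq. (3)] -/
theorem ObsStiffnessSeqCeilingAt_halfFilling_mottStation_mirrorFanPriced_rightLeaf (Uo₂ : ℝ) (hU₀ : 0 ≤ U₀)
    (hX : ∀ (ω : InfVolFermionState 2) (Ls : ℕ → ℕ) (ψ : ∀ L, Fock (Orb (FermionTorus 2 L))),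
      Tendsto Ls atTop atTop →
      (∀ j, IsGroundStateInSector (hubbardTorusTT' (Ls j) 1 0 U₀) (rectN 1 (Ls j)) 0 (ψ (Ls j))) →
      (∀ j, star (ψ (Ls j)) ⬝ᵥ ψ (Ls j) = 1) → ω.IsTorusLimitOf ψ Ls →
      -(∑ i : Fin 2, -(1 : ℝ) * ∑ σ : Fin 2,
          ((ω.expect {0, 0 + unitVec i}
              ((cAt 0 (mem_insert_self _ _) σ)ᴴ * cAt (0 + unitVec i) (mem_insert_of_mem (mem_singleton_self _)) σ)).re +
            (ω.expect {0, 0 + unitVec i}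
              ((cAt (0 + unitVec i) (mem_insert_of_mem (mem_singleton_self _)) σ)ᴴ * cAt 0 (mem_insert_self _ _) σ)).re)) ≤ X)
    (hU₂0 : 0 ≤ U₂) {v₂ : ℝ}
    (h₂ : ∀ (ω : InfVolFermionState 2) (Ls : ℕ → ℕ) (ψ : ∀ L, Fock (Orb (FermionTorus 2 L))),
      Tendsto Ls atTop atTop →
      (∀ j, IsGroundStateInSector (hubbardTorusTT' (Ls j) 1 s₂ U₂) (rectN 1 (Ls j)) 0 (ψ (Ls j))) →
      (∀ j, star (ψ (Ls j)) ⬝ᵥ ψ (Ls j) = 1) → ω.IsTorusLimitOf ψ Ls →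
      v₂ ≤ ((Finset.univ : Finset (DihedralGroup 4)).card : ℝ)⁻¹ * ∑ g ∈ (Finset.univ : Finset (DihedralGroup 4)),
        (ω.expect (d4ShiftSet g 0 (box 2 7)) (fermionEmbed (PolySite.d4Emb g 0 (box 2 7)) (-oddMomentObsTT s₂ Uo₂ 0))).re)
    {A₂ : ℝ}
    (hA₂ : ∀ (ω : InfVolFermionState 2) (Ls : ℕ → ℕ) (ψ : ∀ L, Fock (Orb (FermionTorus 2 L))),
      Tendsto Ls atTop atTop →
      (∀ j, IsGroundStateInSector (hubbardTorusTT' (Ls j) 1 s₂ U₂) (rectN 1 (Ls j)) 0 (ψ (Ls j))) →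
      (∀ j, star (ψ (Ls j)) ⬝ᵥ ψ (Ls j) = 1) → ω.IsTorusLimitOf ψ Ls →
      ω.meanEnergy (hubbardTTPrimeFermionInteraction 0 1 0) 1 ≤ A₂)
    (hUA : U₀ < UP) (hUB : U₂ < UP) (ht : 0 ≤ t'P)
    (hpriced : -((UP * (-s₂) - U₂ * t'P) / (UP - U₂)) ≤ 2 * s₂) (hright : 2 * t'P < (UP * (-s₂) - U₂ * t'P) / (UP - U₂)) (c : ℚ)
    (hc : ((UP * (-s₂) - U₂ * t'P) / (UP - U₂) - 2 * t'P) / ((UP * (-s₂) - U₂ * t'P) / (UP - U₂) - (UP * 0 - U₀ * t'P) / (UP - U₀)) * (X / 4) +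
      (2 * t'P - (UP * 0 - U₀ * t'P) / (UP - U₀)) / ((UP * (-s₂) - U₂ * t'P) / (UP - U₂) - (UP * 0 - U₀ * t'P) / (UP - U₀)) *
        (-v₂ + (2 * s₂ + (UP * (-s₂) - U₂ * t'P) / (UP - U₂)) * A₂ / 4) ≤ ((c : ℚ) : ℝ)) :
    ObsStiffnessSeqCeilingAt t'P UP 1 c := by
  have hd : 0 < UP - U₀ := by linarith
  have hL : (UP * 0 - U₀ * t'P) / (UP - U₀) ≤ 2 * t'P := by
    rw [div_le_iff₀ hd]; nlinarith [mul_nonneg ht (by linarith : 0 ≤ 2 * UP - U₀)]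
  have hlt : (UP * 0 - U₀ * t'P) / (UP - U₀) < (UP * (-s₂) - U₂ * t'P) / (UP - U₂) := lt_of_le_of_lt hL hright
  obtain ⟨hμ₁, hμ₂, hsum, hcomb⟩ := bracket_weights hlt hL hright.le
  have hfloor := hoppingFloor_of_ownSlot_orbitLower_of_diagHop_le Uo₂ v₂ hpriced h₂ hA₂
  have hwit := exists_torusLimit_halfFilling_mirror_hoppingFloor (-((UP * (-s₂) - U₂ * t'P) / (UP - U₂))) hfloor
  simp only [neg_neg] at hwit
  refine ObsStiffnessSeqCeilingAt_of_two_apexSourceWitnesses_weighted (s₁ := 0) (s₂ := -s₂) (n := 1) hU₀ hUA hU₂0 hUB zero_le_one one_lt_two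
    hμ₁ hμ₂ hsum hcomb
    (exists_torusLimit_halfFilling_tp0_hoppingFloor_of_negKinetic_le ((UP * 0 - U₀ * t'P) / (UP - U₀)) hX) hwit c ?_
  have e : -(((UP * (-s₂) - U₂ * t'P) / (UP - U₂) - 2 * t'P) / ((UP * (-s₂) - U₂ * t'P) / (UP - U₂) - (UP * 0 - U₀ * t'P) / (UP - U₀)) * (-X) +
      (2 * t'P - (UP * 0 - U₀ * t'P) / (UP - U₀)) / ((UP * (-s₂) - U₂ * t'P) / (UP - U₂) - (UP * 0 - U₀ * t'P) / (UP - U₀)) *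
        (4 * v₂ + (-((UP * (-s₂) - U₂ * t'P) / (UP - U₂)) - 2 * s₂) * A₂)) / 4 =
      ((UP * (-s₂) - U₂ * t'P) / (UP - U₂) - 2 * t'P) / ((UP * (-s₂) - U₂ * t'P) / (UP - U₂) - (UP * 0 - U₀ * t'P) / (UP - U₀)) * (X / 4) +
      (2 * t'P - (UP * 0 - U₀ * t'P) / (UP - U₀)) / ((UP * (-s₂) - U₂ * t'P) / (UP - U₂) - (UP * 0 - U₀ * t'P) / (UP - U₀)) *
        (-v₂ + (2 * s₂ + (UP * (-s₂) - U₂ * t'P) / (UP - U₂)) * A₂ / 4) := by ring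
  rw [e]; exact hc

end RightLeaves

end Summit.Ventures.CertifiedManyBodySolver.Observables

end
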